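import Summits.BirchSwinnertonDyer.BirchSwinnertonDyer.Theorems.KolyvaginDepthDoorKNSupplyCompositionV10
import HarnessLib

/-!
# Route `KolyvaginDepthDoor`, crux `KolyvaginDepthSupplyKN` (stmt-BirchSwinnertonDyer-22820) —
# THE OPEN STUB (S♭) SPLIT INTO ITS TWO INDEPENDENT HALVES: (X1♭∞) «`Ш(E)[p] = 0` at admissible
# primes above every bound» and (TC∀) «twist `p`-Selmer supply at every large admissible prime»

Helper file of the lead prover (kdd-p1 g14; `--supports stmt-BirchSwinnertonDyer-22820 --as helper`);
it closes nothing and BSD is not proved by it.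

Skeleton v10's only open stub (S♭) asks, for each non-CM `E` of analytic rank `≥ 2`, for ONE admissible
Kodaira–Néron prime `p` and ONE Heegner field `K` carrying BOTH `Ш(E/ℚ)[p] = 0` AND the twist condition
`TC(E, p, K)`. The two demands are of different natures — the first is KatoTransfer's X1 at the torsion
level (SelmerRankBarrierNarrow), the second a `p`-SELMER SUPPLY STATEMENT IN A QUADRATIC-TWIST FAMILY AT
A FIXED PRIME — and (S♭) follows from their «cofinal» forms, which need not share a witness:

* (X1♭∞) `∀ E` non-CM, `ord L(E) ≥ 2`, `∀ B`, `∃ p > B` admissible Kodaira–Néron with `Ш(E/ℚ)[p] = 0`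
  (weaker than v9's (1′) «for ALL large `p`»; still X1-hard);
* (TC∀) `∀ E` non-CM, `ord L(E) ≥ 2`, `∃ B`, `∀ p > B` prime, `∃ K` imaginary quadratic Heegner
  (`d_K` odd, `≠ −3, −4`, `p ∤ d_K`, `p` split) with `TC(E, p, K)` — print only for `w(E) = −1`
  without the Heegner constraints (Ono–Skinner 1998 / Kohnen–Ono 1999: rank-0 twists with
  `ℓ ∤ #Ш(E^{(d)})` for almost every `ℓ`); for `w(E) = +1` (rank 2) it asks Heegner twists of
  `p`-Selmer rank `1` at a given `p ≥ 5` — not in print.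

* `shaTrivialTwistCondition_of_cofinal_of_twistSupply` — (X1♭∞) ∧ (TC∀) ⟹ (S♭).
* `kolyvaginDepthSupplyKN_of_cofinal_of_twistSupply` — hence (X1♭∞) + (TC∀) + nine print facts ⟹
  `KolyvaginDepthSupplyKN`.

This records the planner's reshaping option in Lean; neither half is registered as a stub of line
`levelone` (its composition needs the SAME `p` in both). CONDITIONAL; BSD is NOT proved by this.

References: [Tate1974] Conj. 1; [KohnenOno1999] Thm. 2 and the introduction (Invent. Math. 135);
[WZhang2014] Lemma 8.4 (1); [CastellaSano2026] Thm. 3.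
-/

set_option linter.dupNamespace false

noncomputable section

open scoped Classical NumberField

namespace Summit.BirchSwinnertonDyer.BirchSwinnertonDyer.Theorems.KolyvaginDepthDoor

open Literature.NumberTheory.EllipticCurves Literature.NumberTheory.EllipticCurves.ModularForms
  WeierstrassCurve IsDedekindDomain
open Summit.BirchSwinnertonDyer.BirchSwinnertonDyer.Theorems
open Summit.BirchSwinnertonDyer.BirchSwinnertonDyer.Theses.KolyvaginDepthDoor

/-- **(X1♭∞) ∧ (TC∀) ⟹ (S♭).** If every non-CM `E` of analytic rank `≥ 2` has admissible
Kodaira–Néron primes `p` with `Ш(E/ℚ)[p] = 0` above every bound, and for all large primes `p` a Heegner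
field `K` (`d_K` odd, `≠ −3, −4`, `p ∤ d_K`, `p` split) meeting the twist condition
`#Sel_p(E^{(d_K)}) ≤ p^{rank E} ∨ (Ш(E^{(d_K)})[p] = 0 ∧ rank E^{(d_K)} = rank E + 1)`, then (S♭) holds:
take `p` above TC∀'s bound with `Ш(E)[p] = 0`, then `K` from TC∀ at that `p`. Pure logic; UNCONDITIONAL
as an implication. [cite: Tate1974, Conj. 1] [cite: WZhang2014, Lemma 8.4 (1) (p. 236)] -/
theorem shaTrivialTwistCondition_of_cofinal_of_twistSupply
    (hX1 : ∀ (W : WeierstrassCurve ℚ) [W.IsElliptic] [W.IsGloballyMinimal], ¬ W.HasCM →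
      2 ≤ W.analyticRank → ∀ B : ℕ,
      ∃ (p : ℕ) (_ : Fact p.Prime), B < p ∧ 5 ≤ p ∧ W.HasGoodReductionAtPrime p ∧
        ¬ (p : ℤ) ∣ W.frobeniusTrace p ∧ (∀ n : ℕ, W.HasSurjectiveModNGaloisRep (p ^ n : ℕ)) ∧
        (∀ v : HeightOneSpectrum (𝓞 ℚ), W.HasMultiplicativeReductionAt v →
          ¬ p ∣ W.ordMinimalDiscriminant v) ∧
        (W.sha ⊓ AddSubgroup.torsionBy W.galH1 (p : ℤ) : AddSubgroup W.galH1) = ⊥)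
    (hTC : ∀ (W : WeierstrassCurve ℚ) [W.IsElliptic] [W.IsGloballyMinimal], ¬ W.HasCM →
      2 ≤ W.analyticRank → ∃ B : ℕ, ∀ (p : ℕ) [Fact p.Prime], B < p →
      ∃ (K : Type) (_ : Field K) (_ : NumberField K), IsImaginaryQuadratic K ∧
        NumberField.discr K ≠ -3 ∧ NumberField.discr K ≠ -4 ∧ Odd (NumberField.discr K) ∧
        ¬ ((p : ℤ) ∣ NumberField.discr K) ∧ SatisfiesHeegnerHypothesis p K ∧
        ∃ (_ : NeZero (W.conductorNorm ℤ)), SatisfiesHeegnerHypothesis (W.conductorNorm ℤ) K ∧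
          (Nat.card ((W.quadraticTwist (NumberField.discr K : ℚ)).selmerGroup p) ≤
              p ^ W.mordellWeilRank ∨
            (((W.quadraticTwist (NumberField.discr K : ℚ)).sha ⊓
                AddSubgroup.torsionBy (W.quadraticTwist (NumberField.discr K : ℚ)).galH1 (p : ℤ) :
                AddSubgroup (W.quadraticTwist (NumberField.discr K : ℚ)).galH1) = ⊥ ∧
              (W.quadraticTwist (NumberField.discr K : ℚ)).mordellWeilRank = W.mordellWeilRank + 1)))
    (W : WeierstrassCurve ℚ) [W.IsElliptic] [W.IsGloballyMinimal] (hcm : ¬ W.HasCM)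
    (h2an : 2 ≤ W.analyticRank) :
    ∃ (p : ℕ) (_ : Fact p.Prime), 5 ≤ p ∧ W.HasGoodReductionAtPrime p ∧
      ¬ (p : ℤ) ∣ W.frobeniusTrace p ∧ (∀ n : ℕ, W.HasSurjectiveModNGaloisRep (p ^ n : ℕ)) ∧
      (∀ v : HeightOneSpectrum (𝓞 ℚ), W.HasMultiplicativeReductionAt v →
        ¬ p ∣ W.ordMinimalDiscriminant v) ∧
      ∃ (K : Type) (_ : Field K) (_ : NumberField K), IsImaginaryQuadratic K ∧
        NumberField.discr K ≠ -3 ∧ NumberField.discr K ≠ -4 ∧ Odd (NumberField.discr K) ∧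
        ¬ ((p : ℤ) ∣ NumberField.discr K) ∧ SatisfiesHeegnerHypothesis p K ∧
        ∃ (_ : NeZero (W.conductorNorm ℤ)), SatisfiesHeegnerHypothesis (W.conductorNorm ℤ) K ∧
          (W.sha ⊓ AddSubgroup.torsionBy W.galH1 (p : ℤ) : AddSubgroup W.galH1) = ⊥ ∧
          (Nat.card ((W.quadraticTwist (NumberField.discr K : ℚ)).selmerGroup p) ≤
              p ^ W.mordellWeilRank ∨
            (((W.quadraticTwist (NumberField.discr K : ℚ)).sha ⊓
                AddSubgroup.torsionBy (W.quadraticTwist (NumberField.discr K : ℚ)).galH1 (p : ℤ) :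
                AddSubgroup (W.quadraticTwist (NumberField.discr K : ℚ)).galH1) = ⊥ ∧
              (W.quadraticTwist (NumberField.discr K : ℚ)).mordellWeilRank = W.mordellWeilRank + 1)) := by
  obtain ⟨B, hB⟩ := hTC W hcm h2an
  obtain ⟨p, hp, hBp, h5, hgood, hord, htower, hKN, hsha⟩ := hX1 W hcm h2an B
  haveI := hp
  obtain ⟨K, iF, iN, hK, hD3, hD4, hodd, hpD, hspl, iNZ, hH, hTC'⟩ := hB p hBp
  exact ⟨p, hp, h5, hgood, hord, htower, hKN, K, iF, iN, hK, hD3, hD4, hodd, hpD, hspl, iNZ, hH, hsha,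
    hTC'⟩

/-- **(X1♭∞) + (TC∀) + nine print facts ⟹ `KolyvaginDepthSupplyKN`** (through (S♭) and the v10
composition `kolyvaginDepthSupplyKN_of_shaTrivialTwistCondition`). CONDITIONAL on its hypotheses;
nothing class-wide is discharged; BSD is not proved by it. [cite: CastellaSano2026, Thm. 3]
[cite: Zanarella2019, Prop. 2.18] [cite: Howard2004, Lemma 1.6.4] [cite: Mazur1978, Cor. 4.1]
[cite: GrossZagier1986, Thm. I.6.3] -/
theorem kolyvaginDepthSupplyKN_of_cofinal_of_twistSupply
    (hX1 : ∀ (W : WeierstrassCurve ℚ) [W.IsElliptic] [W.IsGloballyMinimal], ¬ W.HasCM →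
      2 ≤ W.analyticRank → ∀ B : ℕ,
      ∃ (p : ℕ) (_ : Fact p.Prime), B < p ∧ 5 ≤ p ∧ W.HasGoodReductionAtPrime p ∧
        ¬ (p : ℤ) ∣ W.frobeniusTrace p ∧ (∀ n : ℕ, W.HasSurjectiveModNGaloisRep (p ^ n : ℕ)) ∧
        (∀ v : HeightOneSpectrum (𝓞 ℚ), W.HasMultiplicativeReductionAt v →
          ¬ p ∣ W.ordMinimalDiscriminant v) ∧
        (W.sha ⊓ AddSubgroup.torsionBy W.galH1 (p : ℤ) : AddSubgroup W.galH1) = ⊥)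
    (hTC : ∀ (W : WeierstrassCurve ℚ) [W.IsElliptic] [W.IsGloballyMinimal], ¬ W.HasCM →
      2 ≤ W.analyticRank → ∃ B : ℕ, ∀ (p : ℕ) [Fact p.Prime], B < p →
      ∃ (K : Type) (_ : Field K) (_ : NumberField K), IsImaginaryQuadratic K ∧
        NumberField.discr K ≠ -3 ∧ NumberField.discr K ≠ -4 ∧ Odd (NumberField.discr K) ∧
        ¬ ((p : ℤ) ∣ NumberField.discr K) ∧ SatisfiesHeegnerHypothesis p K ∧
        ∃ (_ : NeZero (W.conductorNorm ℤ)), SatisfiesHeegnerHypothesis (W.conductorNorm ℤ) K ∧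
          (Nat.card ((W.quadraticTwist (NumberField.discr K : ℚ)).selmerGroup p) ≤
              p ^ W.mordellWeilRank ∨
            (((W.quadraticTwist (NumberField.discr K : ℚ)).sha ⊓
                AddSubgroup.torsionBy (W.quadraticTwist (NumberField.discr K : ℚ)).galH1 (p : ℤ) :
                AddSubgroup (W.quadraticTwist (NumberField.discr K : ℚ)).galH1) = ⊥ ∧
              (W.quadraticTwist (NumberField.discr K : ℚ)).mordellWeilRank = W.mordellWeilRank + 1)))
    (hPrint : exists_isNewformOf ∧ HoffsteinLuo1997_exists_twist_L_one_ne_zero ∧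
      bumpFriedbergHoffstein_exists_heegnerField_split_twist_simpleZero ∧
      rank_eq_analyticRank_of_analyticRank_le_one)
    (hGZ : ∀ (W : WeierstrassCurve ℚ) (N : ℕ) [NeZero N] (K : Type) [Field K] [NumberField K],
      analyticRankEK_eq_one_iff_heegner_nonTorsion W N K)
    (hRes : Literature.NumberTheory.EllipticCurves.CastellaSano2026_kolyvaginClass_selmerDivisibility_eq_padicValNat_tamagawaProduct ∧
      Literature.NumberTheory.EllipticCurves.Zanarella2019_kolyvaginClass_one_ne_zero_of_not_selmerDivisible ∧
      Literature.NumberTheory.EllipticCurves.HowardZanarella_exists_minimal_kolyvaginClass_one_selmerCard_of_ne_zero)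
    (hMaz : mazur_not_dvd_maninConstant_of_odd) :
    KolyvaginDepthSupplyKN :=
  kolyvaginDepthSupplyKN_of_shaTrivialTwistCondition
    (fun W _ _ hW h2 ↦ shaTrivialTwistCondition_of_cofinal_of_twistSupply hX1 hTC W hW h2)
    hPrint hGZ hRes hMaz

end Summit.BirchSwinnertonDyer.BirchSwinnertonDyer.Theorems.KolyvaginDepthDoor

end
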